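import Summits.HodgeConjecture.HodgeConjecture.Theorems.Ring2WeilCoverageCMFieldIrrationalRowsNonGalois
import HarnessLib

/-!
# Ring 2 — Weil-family coverage, CM-field rows: the `|T| = 4, 6` rows of the non-Galois `D₄` table are
  INTEGER ROWS — explicit norm witnesses (WEIL-FAMILY-COVERAGE «## b03», cells (xv″)/(xvi′))

research route conditional on HC_CM; not a corollary; Q11.4-sentence-2 already refuted in dim ≥ 3.

`E = ℚ(√-(3+√2)) = F(η)`, `F = ℚ(√2) = ℚ[S]/(S² + 6S + 7)` (`σ = −(3+√2)`, `√2 = −(σ+3)`, `η² = σ`; `h(E) = 2`,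
closure group `D₄`).  The components of the `g = 8` Weil family over `E` are indexed by Deligne's discriminant
`δ ∈ F^×/Nm_{E/F}(E^×)` [cite: Deligne1982HodgeCycles, §4: display (1) and Cor. 4.2 — p. 28 of the re-edition of
LNM 900]; §b03.5 of the census numbers the first six non-split places of `E/F` as
`S6 = {1: (2,√2), 2: (7,√2+3), 3: (17,√2+6), 4: (23,√2−5), 5: (5), 6: (41,√2+17)}` and tabulates one representative per
even `T ⊆ S6`.  For this field EVERY such class has a rational member (b03.22 (3)(b): `T(3) = {1,2}`, `T(5) = {2,5}`,
`T(17) = {2,3}`, `T(23) = {1,4}`, `T(41) = {2,6}` span all even subsets of `S6`); `Ring2WeilCoverageCMFieldIrrationalRowsNonGalois`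
§3 proved it for the three `|T| = 2` rows marked «–» in §b03.5.  THIS FILE does the same for the ten `|T| = 4, 6`
representatives of b03.25 P.S. (xv′) (ring2-b03 gen 60; box `≤ 400` + products): for each, `[δ] = [n]` with
`n = ∏_{ℓ : T(ℓ) in the decomposition of T} ℓ` squarefree, by ONE application of `mk_eq_mk_intCast_of_coords` to an
integer witness `(A + Bσ)² − σ(C + Dσ)² = n·(u + vσ)` (found by PARI `rnfisnorm`, kit job j224446; each identity
is re-verified here by `norm_num`).  With §b03.5's box-60 rows (all integer-indexed) the 32 classes `T ⊆ S6` of the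
`D₄` table are thereby ALL identified with integer rows `[n]` in the kernel or by the landed integer classification.
No new definition, no named fact, no sorry.
-/

noncomputable section

set_option linter.dupNamespace false

open Polynomial

namespace Summit.HodgeConjecture.HodgeConjecture.Ring2.WeilCoverageCM

open Literature.AlgebraicGeometry.Deligne1982

/-- **`[140 − 5√2] = [1955]` for `ℚ(√-(3+√2))`** (`√2 = −(σ+3)`: `140 − 5√2 = 155 + 5σ`;
row `T` = {1,3,4,5} = {(2,y), (17,y+6), (23,y−5), (5)} of §b03.5 ∕ b03.25 P.S. (xv′), `N_{F/ℚ}(δ) = 19550`;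
`n = 1955 = 5·17·23`, `T(n) = T`; witness `x = -1075 − 350σ`, `y = 215 + 70σ`:
`x² − σy² = 1955·(155 + 5σ)` — PARI `rnfisnorm`, kit j224446, re-verified by `norm_num`).
[cite: Deligne1982HodgeCycles, §4 (1), p. 28 of the re-edition] -/
theorem sqrtNegThreePlusSqrtTwo_mk_row1345_eq_mk_1955 {R : Polynomial ℤ} (hR : R = X ^ 2 + C 6 * X + C 7)
    [Fact (Irreducible (realPolyQ R))] (δ : (realField R)ˣ)
    (hδ : (δ : realField R) = AdjoinRoot.of (realPolyQ R) (155 : ℤ) + AdjoinRoot.of (realPolyQ R) (5 : ℤ) * AdjoinRoot.root (realPolyQ R))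
    (γ : (realField R)ˣ) (hγ : (γ : realField R) = AdjoinRoot.of (realPolyQ R) (1955 : ℤ)) :
    (QuotientGroup.mk δ : cmNormResidueGroup R) = QuotientGroup.mk γ := by
  haveI : Fact (Irreducible (cmPolyQ R)) := fact_irreducible_cmPolyQ_of_pos hR (by norm_num) (by norm_num) disc_not_sq_six_seven
  exact mk_eq_mk_intCast_of_coords hR (155) (5) 1955 (-1075) (-350) (215) (70) (by norm_num) (by norm_num) δ hδ γ hγ

/-- **`[200 − 63√2] = [16031]` for `ℚ(√-(3+√2))`** (`√2 = −(σ+3)`: `200 − 63√2 = 389 + 63σ`;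
row `T` = {1,3,4,6} = {(2,y), (17,y+6), (23,y−5), (41,y+17)} of §b03.5 ∕ b03.25 P.S. (xv′), `N_{F/ℚ}(δ) = 32062`;
`n = 16031 = 17·23·41`, `T(n) = T`; witness `x = 1374 + 511σ`, `y = -2308 − 415σ`:
`x² − σy² = 16031·(389 + 63σ)` — PARI `rnfisnorm`, kit j224446, re-verified by `norm_num`).
[cite: Deligne1982HodgeCycles, §4 (1), p. 28 of the re-edition] -/
theorem sqrtNegThreePlusSqrtTwo_mk_row1346_eq_mk_16031 {R : Polynomial ℤ} (hR : R = X ^ 2 + C 6 * X + C 7)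
    [Fact (Irreducible (realPolyQ R))] (δ : (realField R)ˣ)
    (hδ : (δ : realField R) = AdjoinRoot.of (realPolyQ R) (389 : ℤ) + AdjoinRoot.of (realPolyQ R) (63 : ℤ) * AdjoinRoot.root (realPolyQ R))
    (γ : (realField R)ˣ) (hγ : (γ : realField R) = AdjoinRoot.of (realPolyQ R) (16031 : ℤ)) :
    (QuotientGroup.mk δ : cmNormResidueGroup R) = QuotientGroup.mk γ := by
  haveI : Fact (Irreducible (cmPolyQ R)) := fact_irreducible_cmPolyQ_of_pos hR (by norm_num) (by norm_num) disc_not_sq_six_seven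
  exact mk_eq_mk_intCast_of_coords hR (389) (63) 16031 (1374) (511) (-2308) (-415) (by norm_num) (by norm_num) δ hδ γ hγ

/-- **`[165 + 70√2] = [10455]` for `ℚ(√-(3+√2))`** (`√2 = −(σ+3)`: `165 + 70√2 = -45 − 70σ`;
row `T` = {1,3,5,6} = {(2,y), (17,y+6), (5), (41,y+17)} of §b03.5 ∕ b03.25 P.S. (xv′), `N_{F/ℚ}(δ) = 17425`;
`n = 10455 = 3·5·17·41`, `T(n) = T`; witness `x = 1110 + 565σ`, `y = 1240 + 380σ`:
`x² − σy² = 10455·(-45 − 70σ)` — PARI `rnfisnorm`, kit j224446, re-verified by `norm_num`).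
[cite: Deligne1982HodgeCycles, §4 (1), p. 28 of the re-edition] -/
theorem sqrtNegThreePlusSqrtTwo_mk_row1356_eq_mk_10455 {R : Polynomial ℤ} (hR : R = X ^ 2 + C 6 * X + C 7)
    [Fact (Irreducible (realPolyQ R))] (δ : (realField R)ˣ)
    (hδ : (δ : realField R) = AdjoinRoot.of (realPolyQ R) (-45 : ℤ) + AdjoinRoot.of (realPolyQ R) (-70 : ℤ) * AdjoinRoot.root (realPolyQ R))
    (γ : (realField R)ˣ) (hγ : (γ : realField R) = AdjoinRoot.of (realPolyQ R) (10455 : ℤ)) :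
    (QuotientGroup.mk δ : cmNormResidueGroup R) = QuotientGroup.mk γ := by
  haveI : Fact (Irreducible (cmPolyQ R)) := fact_irreducible_cmPolyQ_of_pos hR (by norm_num) (by norm_num) disc_not_sq_six_seven
  exact mk_eq_mk_intCast_of_coords hR (-45) (-70) 10455 (1110) (565) (1240) (380) (by norm_num) (by norm_num) δ hδ γ hγ

/-- **`[195 − 85√2] = [4715]` for `ℚ(√-(3+√2))`** (`√2 = −(σ+3)`: `195 − 85√2 = 450 + 85σ`;
row `T` = {1,4,5,6} = {(2,y), (23,y−5), (5), (41,y+17)} of §b03.5 ∕ b03.25 P.S. (xv′), `N_{F/ℚ}(δ) = 23575`;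
`n = 4715 = 5·23·41`, `T(n) = T`; witness `x = -610 − 220σ`, `y = -1350 − 255σ`:
`x² − σy² = 4715·(450 + 85σ)` — PARI `rnfisnorm`, kit j224446, re-verified by `norm_num`).
[cite: Deligne1982HodgeCycles, §4 (1), p. 28 of the re-edition] -/
theorem sqrtNegThreePlusSqrtTwo_mk_row1456_eq_mk_4715 {R : Polynomial ℤ} (hR : R = X ^ 2 + C 6 * X + C 7)
    [Fact (Irreducible (realPolyQ R))] (δ : (realField R)ˣ)
    (hδ : (δ : realField R) = AdjoinRoot.of (realPolyQ R) (450 : ℤ) + AdjoinRoot.of (realPolyQ R) (85 : ℤ) * AdjoinRoot.root (realPolyQ R))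
    (γ : (realField R)ˣ) (hγ : (γ : realField R) = AdjoinRoot.of (realPolyQ R) (4715 : ℤ)) :
    (QuotientGroup.mk δ : cmNormResidueGroup R) = QuotientGroup.mk γ := by
  haveI : Fact (Irreducible (cmPolyQ R)) := fact_irreducible_cmPolyQ_of_pos hR (by norm_num) (by norm_num) disc_not_sq_six_seven
  exact mk_eq_mk_intCast_of_coords hR (450) (85) 4715 (-610) (-220) (-1350) (-255) (by norm_num) (by norm_num) δ hδ γ hγ

/-- **`[135 + 65√2] = [5865]` for `ℚ(√-(3+√2))`** (`√2 = −(σ+3)`: `135 + 65√2 = -60 − 65σ`;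
row `T` = {2,3,4,5} = {(7,y+3), (17,y+6), (23,y−5), (5)} of §b03.5 ∕ b03.25 P.S. (xv′), `N_{F/ℚ}(δ) = 9775`;
`n = 5865 = 3·5·17·23`, `T(n) = T`; witness `x = -670 − 400σ`, `y = 525 + 80σ`:
`x² − σy² = 5865·(-60 − 65σ)` — PARI `rnfisnorm`, kit j224446, re-verified by `norm_num`).
[cite: Deligne1982HodgeCycles, §4 (1), p. 28 of the re-edition] -/
theorem sqrtNegThreePlusSqrtTwo_mk_row2345_eq_mk_5865 {R : Polynomial ℤ} (hR : R = X ^ 2 + C 6 * X + C 7)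
    [Fact (Irreducible (realPolyQ R))] (δ : (realField R)ˣ)
    (hδ : (δ : realField R) = AdjoinRoot.of (realPolyQ R) (-60 : ℤ) + AdjoinRoot.of (realPolyQ R) (-65 : ℤ) * AdjoinRoot.root (realPolyQ R))
    (γ : (realField R)ˣ) (hγ : (γ : realField R) = AdjoinRoot.of (realPolyQ R) (5865 : ℤ)) :
    (QuotientGroup.mk δ : cmNormResidueGroup R) = QuotientGroup.mk γ := by
  haveI : Fact (Irreducible (cmPolyQ R)) := fact_irreducible_cmPolyQ_of_pos hR (by norm_num) (by norm_num) disc_not_sq_six_seven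
  exact mk_eq_mk_intCast_of_coords hR (-60) (-65) 5865 (-670) (-400) (525) (80) (by norm_num) (by norm_num) δ hδ γ hγ

/-- **`[137 + 37√2] = [48093]` for `ℚ(√-(3+√2))`** (`√2 = −(σ+3)`: `137 + 37√2 = 26 − 37σ`;
row `T` = {2,3,4,6} = {(7,y+3), (17,y+6), (23,y−5), (41,y+17)} of §b03.5 ∕ b03.25 P.S. (xv′), `N_{F/ℚ}(δ) = 16031`;
`n = 48093 = 3·17·23·41`, `T(n) = T`; witness `x = -2619 − 589σ`, `y = -571 + 196σ`:
`x² − σy² = 48093·(26 − 37σ)` — PARI `rnfisnorm`, kit j224446, re-verified by `norm_num`).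
[cite: Deligne1982HodgeCycles, §4 (1), p. 28 of the re-edition] -/
theorem sqrtNegThreePlusSqrtTwo_mk_row2346_eq_mk_48093 {R : Polynomial ℤ} (hR : R = X ^ 2 + C 6 * X + C 7)
    [Fact (Irreducible (realPolyQ R))] (δ : (realField R)ˣ)
    (hδ : (δ : realField R) = AdjoinRoot.of (realPolyQ R) (26 : ℤ) + AdjoinRoot.of (realPolyQ R) (-37 : ℤ) * AdjoinRoot.root (realPolyQ R))
    (γ : (realField R)ˣ) (hγ : (γ : realField R) = AdjoinRoot.of (realPolyQ R) (48093 : ℤ)) :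
    (QuotientGroup.mk δ : cmNormResidueGroup R) = QuotientGroup.mk γ := by
  haveI : Fact (Irreducible (cmPolyQ R)) := fact_irreducible_cmPolyQ_of_pos hR (by norm_num) (by norm_num) disc_not_sq_six_seven
  exact mk_eq_mk_intCast_of_coords hR (26) (-37) 48093 (-2619) (-589) (-571) (196) (by norm_num) (by norm_num) δ hδ γ hγ

/-- **`[190 − 25√2] = [3485]` for `ℚ(√-(3+√2))`** (`√2 = −(σ+3)`: `190 − 25√2 = 265 + 25σ`;
row `T` = {2,3,5,6} = {(7,y+3), (17,y+6), (5), (41,y+17)} of §b03.5 ∕ b03.25 P.S. (xv′), `N_{F/ℚ}(δ) = 34850`;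
`n = 3485 = 5·17·41`, `T(n) = T`; witness `x = -750 − 5σ`, `y = 575 + 120σ`:
`x² − σy² = 3485·(265 + 25σ)` — PARI `rnfisnorm`, kit j224446, re-verified by `norm_num`).
[cite: Deligne1982HodgeCycles, §4 (1), p. 28 of the re-edition] -/
theorem sqrtNegThreePlusSqrtTwo_mk_row2356_eq_mk_3485 {R : Polynomial ℤ} (hR : R = X ^ 2 + C 6 * X + C 7)
    [Fact (Irreducible (realPolyQ R))] (δ : (realField R)ˣ)
    (hδ : (δ : realField R) = AdjoinRoot.of (realPolyQ R) (265 : ℤ) + AdjoinRoot.of (realPolyQ R) (25 : ℤ) * AdjoinRoot.root (realPolyQ R))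
    (γ : (realField R)ˣ) (hγ : (γ : realField R) = AdjoinRoot.of (realPolyQ R) (3485 : ℤ)) :
    (QuotientGroup.mk δ : cmNormResidueGroup R) = QuotientGroup.mk γ := by
  haveI : Fact (Irreducible (cmPolyQ R)) := fact_irreducible_cmPolyQ_of_pos hR (by norm_num) (by norm_num) disc_not_sq_six_seven
  exact mk_eq_mk_intCast_of_coords hR (265) (25) 3485 (-750) (-5) (575) (120) (by norm_num) (by norm_num) δ hδ γ hγ

/-- **`[220 + 25√2] = [14145]` for `ℚ(√-(3+√2))`** (`√2 = −(σ+3)`: `220 + 25√2 = 145 − 25σ`;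
row `T` = {2,4,5,6} = {(7,y+3), (23,y−5), (5), (41,y+17)} of §b03.5 ∕ b03.25 P.S. (xv′), `N_{F/ℚ}(δ) = 47150`;
`n = 14145 = 3·5·23·41`, `T(n) = T`; witness `x = -1465 + 90σ`, `y = -305 − 110σ`:
`x² − σy² = 14145·(145 − 25σ)` — PARI `rnfisnorm`, kit j224446, re-verified by `norm_num`).
[cite: Deligne1982HodgeCycles, §4 (1), p. 28 of the re-edition] -/
theorem sqrtNegThreePlusSqrtTwo_mk_row2456_eq_mk_14145 {R : Polynomial ℤ} (hR : R = X ^ 2 + C 6 * X + C 7)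
    [Fact (Irreducible (realPolyQ R))] (δ : (realField R)ˣ)
    (hδ : (δ : realField R) = AdjoinRoot.of (realPolyQ R) (145 : ℤ) + AdjoinRoot.of (realPolyQ R) (-25 : ℤ) * AdjoinRoot.root (realPolyQ R))
    (γ : (realField R)ˣ) (hγ : (γ : realField R) = AdjoinRoot.of (realPolyQ R) (14145 : ℤ)) :
    (QuotientGroup.mk δ : cmNormResidueGroup R) = QuotientGroup.mk γ := by
  haveI : Fact (Irreducible (cmPolyQ R)) := fact_irreducible_cmPolyQ_of_pos hR (by norm_num) (by norm_num) disc_not_sq_six_seven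
  exact mk_eq_mk_intCast_of_coords hR (145) (-25) 14145 (-1465) (90) (-305) (-110) (by norm_num) (by norm_num) δ hδ γ hγ

/-- **`[685 + 185√2] = [240465]` for `ℚ(√-(3+√2))`** (`√2 = −(σ+3)`: `685 + 185√2 = 130 − 185σ`;
row `T` = {3,4,5,6} = {(17,y+6), (23,y−5), (5), (41,y+17)} of §b03.5 ∕ b03.25 P.S. (xv′) (product representative), `N_{F/ℚ}(δ) = 400775`;
`n = 240465 = 3·5·17·23·41`, `T(n) = T`; witness `x = -13095 − 2945σ`, `y = -2855 + 980σ`: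
`x² − σy² = 240465·(130 − 185σ)` — PARI `rnfisnorm`, kit j224446, re-verified by `norm_num`).
[cite: Deligne1982HodgeCycles, §4 (1), p. 28 of the re-edition] -/
theorem sqrtNegThreePlusSqrtTwo_mk_row3456_eq_mk_240465 {R : Polynomial ℤ} (hR : R = X ^ 2 + C 6 * X + C 7)
    [Fact (Irreducible (realPolyQ R))] (δ : (realField R)ˣ)
    (hδ : (δ : realField R) = AdjoinRoot.of (realPolyQ R) (130 : ℤ) + AdjoinRoot.of (realPolyQ R) (-185 : ℤ) * AdjoinRoot.root (realPolyQ R))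
    (γ : (realField R)ˣ) (hγ : (γ : realField R) = AdjoinRoot.of (realPolyQ R) (240465 : ℤ)) :
    (QuotientGroup.mk δ : cmNormResidueGroup R) = QuotientGroup.mk γ := by
  haveI : Fact (Irreducible (cmPolyQ R)) := fact_irreducible_cmPolyQ_of_pos hR (by norm_num) (by norm_num) disc_not_sq_six_seven
  exact mk_eq_mk_intCast_of_coords hR (130) (-185) 240465 (-13095) (-2945) (-2855) (980) (by norm_num) (by norm_num) δ hδ γ hγ

/-- **`[1000 − 315√2] = [80155]` for `ℚ(√-(3+√2))`** (`√2 = −(σ+3)`: `1000 − 315√2 = 1945 + 315σ`;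
row `T` = {1,2,3,4,5,6} = {(2,y), (7,y+3), (17,y+6), (23,y−5), (5), (41,y+17)} of §b03.5 ∕ b03.25 P.S. (xv′) (product representative), `N_{F/ℚ}(δ) = 801550`;
`n = 80155 = 5·17·23·41`, `T(n) = T`; witness `x = 6870 + 2555σ`, `y = -11540 − 2075σ`:
`x² − σy² = 80155·(1945 + 315σ)` — PARI `rnfisnorm`, kit j224446, re-verified by `norm_num`).
[cite: Deligne1982HodgeCycles, §4 (1), p. 28 of the re-edition] -/
theorem sqrtNegThreePlusSqrtTwo_mk_row123456_eq_mk_80155 {R : Polynomial ℤ} (hR : R = X ^ 2 + C 6 * X + C 7)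
    [Fact (Irreducible (realPolyQ R))] (δ : (realField R)ˣ)
    (hδ : (δ : realField R) = AdjoinRoot.of (realPolyQ R) (1945 : ℤ) + AdjoinRoot.of (realPolyQ R) (315 : ℤ) * AdjoinRoot.root (realPolyQ R))
    (γ : (realField R)ˣ) (hγ : (γ : realField R) = AdjoinRoot.of (realPolyQ R) (80155 : ℤ)) :
    (QuotientGroup.mk δ : cmNormResidueGroup R) = QuotientGroup.mk γ := by
  haveI : Fact (Irreducible (cmPolyQ R)) := fact_irreducible_cmPolyQ_of_pos hR (by norm_num) (by norm_num) disc_not_sq_six_seven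
  exact mk_eq_mk_intCast_of_coords hR (1945) (315) 80155 (6870) (2555) (-11540) (-2075) (by norm_num) (by norm_num) δ hδ γ hγ

end Summit.HodgeConjecture.HodgeConjecture.Ring2.WeilCoverageCM

end
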